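import Mathlib
import Literature.Barriers.ValiantsHypothesis.CKRST20NaturalProofsExist
import Literature.Barriers.ValiantsHypothesis.GKSS17FSVPresentation
import Summits.ValiantsHypothesis.ValiantsHypothesis.Theorems.BarrierLeverNaturalProofsSeparateVNPSignSliceCoeffs
import Summits.ValiantsHypothesis.ValiantsHypothesis.Theorems.BarrierLeverNaturalProofsSeparateVNPSignSliceZeroPatterns
import Summits.ValiantsHypothesis.ValiantsHypothesis.Theorems.BarrierLeverNaturalProofsSeparateVNPSignSliceHittingPoint
import Summits.ValiantsHypothesis.ValiantsHypothesis.Theorems.BarrierLeverNaturalProofsSeparateVNPSignSliceParamGen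
import HarnessLib

/-!
# Item `BarrierLever.NaturalProofsSeparateVNP` (stmt-ValiantsHypothesis-18972), SIGN SLICE —
# part 9: ONE integer point hits every sign polynomial of CKRST's class `𝒞(n, d, s)` (general degree)

Generalises part 3 (`…SignSliceHittingPoint.lean`, FSV frame `d = n`) to CKRST's degree-`d` slice
`vpSlice ℂ n d s` (`CKRST20NaturalProofsExist.lean`), as needed for the AS-PRINTED CKRST 2020
Thm. 1.1: the finite set of sign polynomials in `vpSlice ℂ n d s` has at most
`(4 d C(n+d,d) + 1)^(9376 (n+d+s+4)^21)` members (Raz parametrisation of part 8 + zero-pattern count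
of part 1 + `GKSS2017.ncard_degLE`), so a Schwartz–Zippel union bound over the grid
`[1, B]^n`, `B = hitBoundGen n d s`, leaves a point `a` with `f(a) ≠ 0` for all of them.

* `HitGen.hitBoundGen n d s = (4 d C(n+d,d) + 1)^(9376 (n+d+s+4)^21) · d + 1`;
* `HitGen.exists_hitting_point` — for `n, d ≥ 1` some `a ∈ [1, hitBoundGen n d s]^n` has `f(a) ≠ 0`
  for every nonzero `f ∈ vpSlice ℂ n d s ∩ signCoeffSlice ℂ n`.

References: [ChatterjeeKumarRamyaSaptharishiTengse2020] Lemma 12 and §4 (Heintz–Schnorr replaced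
as in part 3); [Raz2010] Prop. 3.3; [RonyaiBabaiGanapathy2001] Thm. 1.1.
-/

-- layout Summits/ValiantsHypothesis/ValiantsHypothesis forces the duplicated namespace component
set_option linter.dupNamespace false

noncomputable section

namespace Summit.ValiantsHypothesis.ValiantsHypothesis.Theorems.BarrierLever.NaturalProofsSeparateVNP

open Literature.Barriers.ValiantsHypothesis Literature.Computability.AlgebraicComplexity MvPolynomial

namespace HitGen

/-- A `Fintype` structure on CKRST's coefficient index set `monomialsDegLE n d` (finite by
Mathlib's `Finsupp.finite_of_degree_le`). [cite: ChatterjeeKumarRamyaSaptharishiTengse2020, Def. 2] -/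
@[reducible] def monFintype (n d : ℕ) : Fintype (monomialsDegLE n d) :=
  (Finsupp.finite_of_degree_le (σ := Fin n) d).fintype

/-- `#monomialsDegLE n d = C(n + d, d)` (the tree's `GKSS2017.ncard_degLE`, as a `Fintype.card`).
[cite: ForbesShpilkaVolk2018, Cor. 5] -/
theorem card_monomialsDegLE (n d : ℕ) [Fintype (monomialsDegLE n d)] :
    Fintype.card (monomialsDegLE n d) = (n + d).choose d := by
  rw [← Nat.card_eq_fintype_card]
  exact GKSS2017.ncard_degLE n d

/-- The monomials of `monomialsDegLE n d` have degree `≤ d`. [cite: ChatterjeeKumarRamyaSaptharishiTengse2020, Def. 2] -/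
theorem degree_le_of_mem (n d : ℕ) (m : monomialsDegLE n d) : (m : Fin n →₀ ℕ).degree ≤ d := m.2

/-- Every exponent vector of degree `≤ d` belongs to `monomialsDegLE n d`. [cite: ChatterjeeKumarRamyaSaptharishiTengse2020, Def. 2] -/
theorem mem_of_degree_le (n d : ℕ) (μ : Fin n →₀ ℕ) (h : μ.degree ≤ d) : μ ∈ monomialsDegLE n d := h

/-- The coordinate bound of the hitting point for `𝒞(n, d, s)`. [cite: ChatterjeeKumarRamyaSaptharishiTengse2020, §4] -/
def hitBoundGen (n d s : ℕ) : ℕ :=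
  (4 * d * (n + d).choose d + 1) ^ (9376 * (n + d + s + 4) ^ 21) * d + 1

/-- `hitBoundGen n d s ≥ 1`. [folklore] -/
theorem one_le_hitBoundGen (n d s : ℕ) : 1 ≤ hitBoundGen n d s := Nat.le_add_left 1 _

/-- **One point hits every sign polynomial of `𝒞(n, d, s)`.** For `n, d ≥ 1` there is
`a ∈ [1, hitBoundGen n d s]^n` with `f(a) ≠ 0` for every nonzero `f ∈ vpSlice ℂ n d s` with
coefficients in `{0, 1, -1}`. [cite: ChatterjeeKumarRamyaSaptharishiTengse2020, Lemma 12 and §4] -/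
theorem exists_hitting_point (n d s : ℕ) (hn : 1 ≤ n) (hd : 1 ≤ d) :
    ∃ a : Fin n → ℕ, (∀ i, 1 ≤ a i ∧ a i ≤ hitBoundGen n d s) ∧
      ∀ f ∈ vpSlice ℂ n d s, f ∈ signCoeffSlice ℂ n → f ≠ 0 →
        eval (fun i => (a i : ℂ)) f ≠ 0 := by
  classical
  letI : Fintype (monomialsDegLE n d) := monFintype n d
  obtain ⟨p, G, hp, hdeg, hG⟩ := ParamGen.exists_parametrization_deg n d s hn hd
  set N := Fintype.card (monomialsDegLE n d) with hN
  have hNc : N = (n + d).choose d := card_monomialsDegLE n d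
  -- the finite class to be hit
  let vecs : Finset (monomialsDegLE n d → ℤ) := Fintype.piFinset fun _ => ({0, 1, -1} : Finset ℤ)
  let T : Finset (MvPolynomial (Fin n) ℂ) :=
    (vecs.image Coeffs.poly).filter (fun f => f ∈ vpSlice ℂ n d s ∧ f ≠ 0)
  have hvecs : ∀ e, e ∈ vecs ↔ ∀ m, e m = 0 ∨ e m = 1 ∨ e m = -1 := by
    intro e; simp [vecs, Fintype.mem_piFinset]
  have hTmem : ∀ f ∈ vpSlice ℂ n d s, f ∈ signCoeffSlice ℂ n → f ≠ 0 → f ∈ T := by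
    intro f hf hs h0
    refine Finset.mem_filter.mpr ⟨Finset.mem_image.mpr ⟨Coeffs.sgnVec (monomialsDegLE n d) f,
      (hvecs _).mpr (Coeffs.sgnVec_mem f),
      Coeffs.poly_sgnVec_of_totalDegree_le (mem_of_degree_le n d) hs hf.1⟩, hf, h0⟩
  have hTvec : ∀ f ∈ T, ∃ e : monomialsDegLE n d → ℤ,
      (∀ m, e m = 0 ∨ e m = 1 ∨ e m = -1) ∧ f = Coeffs.poly e := by
    intro f hf
    obtain ⟨e, he, rfl⟩ := Finset.mem_image.mp (Finset.mem_filter.mp hf).1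
    exact ⟨e, (hvecs e).mp he, rfl⟩
  -- its size, by the zero-pattern count
  have hTcard : T.card ≤ (2 * N * (2 * d) + 1) ^ p := by
    have hinj : Set.InjOn (coeffVector (monomialsDegLE n d)) (T : Set (MvPolynomial (Fin n) ℂ)) := by
      intro f hf g hg hfg
      obtain ⟨e, -, rfl⟩ := hTvec f hf
      obtain ⟨e', -, rfl⟩ := hTvec g hg
      rw [Coeffs.coeffVector_poly, Coeffs.coeffVector_poly] at hfg
      have : e = e' := funext fun m => by exact_mod_cast congrFun hfg m
      rw [this]
    rw [← Finset.card_image_of_injOn hinj]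
    refine ZeroPatterns.card_le_of_signVectors_mem_image G hdeg _ ?_ ?_
    · intro c hc m
      obtain ⟨f, hf, rfl⟩ := Finset.mem_image.mp hc
      obtain ⟨e, he, rfl⟩ := hTvec f hf
      rw [Coeffs.coeffVector_poly]
      rcases he m with h | h | h <;> simp [h]
    · intro c hc
      obtain ⟨f, hf, rfl⟩ := Finset.mem_image.mp hc
      obtain ⟨y, hy⟩ := hG f (Finset.mem_filter.mp hf).2.1
      exact ⟨y, fun m => by rw [hy m, coeffVector_apply]⟩
  -- the explicit bound
  set Z := (4 * d * (n + d).choose d + 1) ^ (9376 * (n + d + s + 4) ^ 21) with hZ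
  have hTZ : T.card ≤ Z := by
    refine hTcard.trans ?_
    calc (2 * N * (2 * d) + 1) ^ p ≤ (4 * d * (n + d).choose d + 1) ^ p := by
          apply Nat.pow_le_pow_left
          rw [hNc]
          have : 2 * (n + d).choose d * (2 * d) = 4 * d * (n + d).choose d := by ring
          omega
      _ ≤ Z := Nat.pow_le_pow_right (Nat.succ_pos _) hp
  set B := Z * d + 1 with hB
  have hBdef : hitBoundGen n d s = B := rfl
  have hB1 : 1 ≤ B := Nat.le_add_left 1 _
  -- the grid `[1, B]^n` inside `ℂ^n`
  let Sg : Finset ℂ := (Finset.Icc 1 B).image (fun k : ℕ => (k : ℂ))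
  have hSg_card : Sg.card = B := by
    rw [Finset.card_image_of_injective _ Nat.cast_injective, Nat.card_Icc]; omega
  have hSg_ne : Sg.Nonempty := by
    rw [← Finset.card_pos, hSg_card]; exact hB1
  let grid : Finset (Fin n → ℂ) := Fintype.piFinset fun _ : Fin n => Sg
  let bad : MvPolynomial (Fin n) ℂ → Finset (Fin n → ℂ) := fun f =>
    grid.filter (fun x => eval x f = 0)
  have hbad : ∀ f ∈ T, (bad f).card * B ≤ d * B ^ n := by
    intro f hf
    obtain ⟨e, -, rfl⟩ := hTvec f hf
    have h0 : Coeffs.poly e ≠ 0 := (Finset.mem_filter.mp hf).2.2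
    have := SignSlice.card_zeros_mul_le h0
      (Coeffs.totalDegree_poly_le (degree_le_of_mem n d) e) Sg hSg_ne
    rwa [hSg_card] at this
  let allbad : Finset (Fin n → ℂ) := T.biUnion bad
  have hallbad : allbad.card < grid.card := by
    have hgrid : grid.card = B ^ n := by
      simp [grid, Fintype.card_piFinset, hSg_card]
    rw [hgrid]
    have h1 : allbad.card * B ≤ T.card * (d * B ^ n) := by
      calc allbad.card * B ≤ (∑ f ∈ T, (bad f).card) * B :=
            Nat.mul_le_mul_right _ (Finset.card_biUnion_le)
        _ = ∑ f ∈ T, (bad f).card * B := Finset.sum_mul _ _ _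
        _ ≤ ∑ _f ∈ T, d * B ^ n := Finset.sum_le_sum hbad
        _ = T.card * (d * B ^ n) := by rw [Finset.sum_const, smul_eq_mul]
    have h2 : T.card * (d * B ^ n) ≤ (Z * d) * B ^ n := by
      rw [← mul_assoc]; exact Nat.mul_le_mul_right _ (Nat.mul_le_mul_right _ hTZ)
    have h3 : Z * d < B := by omega
    by_contra hge
    push Not at hge
    have hBn : 0 < B ^ n := pow_pos (by omega) n
    have : B * B ^ n ≤ (Z * d) * B ^ n :=
      calc B * B ^ n ≤ allbad.card * B := by rw [mul_comm]; exact Nat.mul_le_mul_right _ hge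
        _ ≤ (Z * d) * B ^ n := h1.trans h2
    have := Nat.le_of_mul_le_mul_right this hBn
    omega
  obtain ⟨x, hxg, hxa⟩ := Finset.exists_mem_notMem_of_card_lt_card hallbad
  -- read off the integer coordinates
  have hxi : ∀ i, ∃ k : ℕ, (1 ≤ k ∧ k ≤ B) ∧ (k : ℂ) = x i := by
    intro i
    have := Fintype.mem_piFinset.mp hxg i
    obtain ⟨k, hk, hkx⟩ := Finset.mem_image.mp this
    exact ⟨k, Finset.mem_Icc.mp hk, hkx⟩
  choose a ha hax using hxi
  have hxeq : (fun i => (a i : ℂ)) = x := funext hax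
  refine ⟨a, fun i => hBdef ▸ ha i, fun f hf hs h0 => ?_⟩
  rw [hxeq]
  intro hzero
  exact hxa (Finset.mem_biUnion.mpr ⟨f, hTmem f hf hs h0, Finset.mem_filter.mpr ⟨hxg, hzero⟩⟩)

end HitGen

end Summit.ValiantsHypothesis.ValiantsHypothesis.Theorems.BarrierLever.NaturalProofsSeparateVNP
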